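import Literature.Analysis.SpecialFunctions.LogTwoBounds
import Mathlib.Analysis.SpecialFunctions.Log.Deriv
import HarnessLib

-- build note (ops-buildfix B18-1, 2026-08-23): re-landed byte-for-byte except this comment, to force every build
-- checkout to recompile the module and replace the disk-full-truncated `KernelLog.olean` copies; no declaration changed.

/-!
# Kernel-evaluable enclosures of `log n` (plan N1 of provefact `Literature.NumberTheory.LFunctions.robin_iff`, step (a))

Topic: `Literature/Analysis/SpecialFunctions`. A *computable* function `logIv : ℕ → Option (ℤ × ℤ)`
returning fixed-point bounds `lo/2⁸⁰ ≤ log n ≤ hi/2⁸⁰` (`logIv_sound`), designed to be *evaluated by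
the kernel* (`decide +kernel`) inside certified numerical computations over many primes (the
colossally abundant chain below `4¹¹`, `RobinAnalyticSharp.robinCA_below`; certified `θ(x)` tables),
where neither `norm_num` per number nor stored tables of logarithms are affordable.

Method: choose `k` with `n/2^k ∈ [2/3, 4/3]` (`findK`), put `x = 1 − n/2^k = a/2^k`, `|x| ≤ 1/3`;
then `log n = k log 2 + log(1 − x)` and `−log(1 − x) = ∑_{j ≤ M} x^j/j + R`,
`|R| ≤ |x|^{M+1}/(1 − |x|) ≤ (3/2) 3^{−(M+1)}` (Mathlib `Real.abs_log_sub_add_sum_range_le`), with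
`M = NTERMS = 26` terms (`LOGREM`); the partial sum is evaluated in fixed point `2⁸⁰` with floor division
(`seriesGo`, error `≤ NTERMS` ulps, `seriesGo_bounds`), and `log 2` enters through the 20-digit enclosure of
`LogTwoBounds.lean` (`L2LO`, `L2HI`). Resulting width `≈ 4·10⁻¹³`; kernel cost `≈ 1.5 ms` per
evaluation (2000 evaluations in `≈ 3 s`). Everything here is PROVED; the only `def`s are the
computable functions and their constants.

Relation to the tree's general engine `Literature/Analysis/ValidatedNumerics/FixedPointInterval.lean`
(`Literature.Analysis.ValidatedNumerics.Numerics.FI`, scale `2⁴⁸`, with `FI.logOneSub`/`mem_logOneSub` for `log(1 − x)`, `0 ≤ x ≤ ½`,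
on the same Mathlib lemma): `logIv` could be assembled from `FI.logOneSub`, `FI.ofFrac` (for `log 2`)
and `FI.mulInt`; a dedicated scalar routine is kept because (i) it is the inner loop of a computation
with `≈ 10⁶` logarithm evaluations in the kernel (the colossally abundant chain), where a signed
argument `|x| ≤ 1/3` (bit length `k` chosen so that `n/2^k ∈ [2/3, 4/3]`) needs a third fewer series
terms than `x ∈ [0, ½]` and no interval bookkeeping per term; (ii) the consumer wants plain scaled
integers `(lo, hi)` at one fixed scale to store in its state. The scale `2⁸⁰` is far finer than the
truncation error (`LOGREM ≈ 2.4·10¹¹` ulps, width `≈ 4·10⁻¹³`); it is kept for headroom in sums of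
`≈ 10⁶` terms. Names are prefixed (`LOGSC`, `NTERMS`, `LOGREM`) so as not to clash with
`Literature.Analysis.ValidatedNumerics.Numerics.SC` when both namespaces are open.

* `logIv_sound : logIv n = some (lo, hi) → lo/2⁸⁰ ≤ log n ∧ log n ≤ hi/2⁸⁰`;
* `log1pIv p q` (`0 ≤ p`, `2p ≤ q`): the same series at `x = −p/q` with an adaptive number of terms
  (`termsFor`, about `48/log₂(q/p)`; e.g. `7` terms for `log(1 + 1/2003)`, width `≈ 10⁻²³`) and the
  exact remainder `(p/q)^{m+1}/(1 − p/q)` (`remBound`); `log1pIv_sound`. This is the cheap primitive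
  for the *increments* `log(1 + 1/(c σ_{j−1}(c)))`, `log c' − log c = log(1 + (c'−c)/c)` along the
  colossally abundant chain (a few terms each instead of a full logarithm).

## References

* Mathlib, `Mathlib/Analysis/SpecialFunctions/Log/Deriv.lean` (`Real.abs_log_sub_add_sum_range_le`)
  and `Mathlib/Analysis/Complex/ExponentialBounds.lean` (the method of `Real.log_two_near_10`).
-/
namespace Literature.Analysis.SpecialFunctions.KernelLog

open Finset

/-- Number of series terms. [folklore] -/
def NTERMS : ℕ := 26

/-- The fixed-point scale `2⁸⁰` (a natural-number power, kernel-accelerated, cast to `ℤ`). [folklore] -/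
def LOGSC : ℤ := ((2 ^ 80 : ℕ) : ℤ)

/-- `⌊log 2 · 2⁸⁰⌋`-type lower constant (from `Literature.Analysis.SpecialFunctions.Real.log_two_gt_d20`). [folklore] -/
def L2LO : ℤ := ⌊(0.69314718055994530940 : ℚ) * 2 ^ 80⌋

/-- Upper constant for `log 2 · 2⁸⁰` (from `Literature.Analysis.SpecialFunctions.Real.log_two_lt_d20`). [folklore] -/
def L2HI : ℤ := ⌈(0.69314718055994530944 : ℚ) * 2 ^ 80⌉

/-- Scaled bound for the series remainder `(3/2)·3^{-(NTERMS+1)}·2⁸⁰`. [folklore] -/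
def LOGREM : ℤ := ⌈(3 / 2 : ℚ) * 2 ^ 80 / 3 ^ (NTERMS + 1)⌉

/-- Bit length by structural recursion on a fuel (`bitLen fuel n = ⌊log₂ n⌋ + 1` for `1 ≤ n < 2^fuel`).
[folklore] -/
def bitLen : ℕ → ℕ → ℕ
  | 0, _ => 0
  | fuel + 1, n => if n < 2 then (if n = 0 then 0 else 1) else bitLen fuel (n / 2) + 1

/-- The exponent `k` with `n/2^k ∈ [2/3, 4/3]`: `k = b − 1` or `b` with `b` the bit length
(validated by the caller; covers `1 ≤ n < 2²⁵⁶`). [folklore] -/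
def findK (n : ℕ) : ℕ :=
  let b := bitLen 256 n
  if 3 * n ≤ 4 * 2 ^ (b - 1) then b - 1 else b

/-- Fixed-point partial sums for `x = a/d`: `go fuel i pow dpow acc` adds `⌊a^j 2⁸⁰/(j d^j)⌋` for
`j = i, …, i+fuel-1` (`pow = a^i`, `dpow = d^i` on entry). [folklore] -/
def seriesGo (a : ℤ) (d : ℕ) : ℕ → ℕ → ℤ → ℕ → ℤ → ℤ
  | 0, _, _, _, acc => acc
  | fuel + 1, i, pow, dpow, acc =>
      seriesGo a d fuel (i + 1) (pow * a) (dpow * d) (acc + pow * LOGSC / ((i : ℤ) * (dpow : ℤ)))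

/-- `s = ∑_{j=1}^{m} ⌊a^j 2⁸⁰/(j d^j)⌋ ≈ 2⁸⁰ ∑_{j ≤ m} x^j/j`, `x = a/d`. [folklore] -/
def seriesSum (a : ℤ) (d : ℕ) (m : ℕ) : ℤ := seriesGo a d m 1 a d 0

/-- Scaled remainder bound `⌈2⁸⁰ · y^{m+1}/(1 − y)⌉` for `y = p/q < 1`. [folklore] -/
def remBound (p q m : ℕ) : ℤ := ⌈(2 : ℚ) ^ 80 * (p : ℚ) ^ (m + 1) / ((q : ℚ) ^ m * ((q : ℚ) - p))⌉

/-- **The enclosure**: `logIv n = some (lo, hi)` with `lo/2⁸⁰ ≤ log n ≤ hi/2⁸⁰` (`logIv_sound`);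
`none` if no admissible `k` was found (never for `1 ≤ n < 2²⁵⁶`). With `x = 1 − n/2^k`, `|x| ≤ 1/3`:
`log n = k log 2 + log(1 − x) = k log 2 − ∑_{j ≤ NTERMS} x^j/j − R`, `|R| ≤ (3/2)|x|^{NTERMS+1}`. [folklore] -/
def logIv (n : ℕ) : Option (ℤ × ℤ) :=
  let k := findK n
  if 2 * 2 ^ k ≤ 3 * n ∧ 3 * n ≤ 4 * 2 ^ k then
    let a : ℤ := ((2 ^ k : ℕ) : ℤ) - n
    let s := seriesSum a (2 ^ k) NTERMS
    some ((k : ℤ) * L2LO - s - NTERMS - LOGREM, (k : ℤ) * L2HI - s + LOGREM)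
  else none

/-- Number of series terms for `log(1 + p/q)` at target precision `2⁻⁴⁸`: about `48/log₂(q/p)`.
[folklore] -/
def termsFor (p q : ℕ) : ℕ :=
  let gap := bitLen 256 q - bitLen 256 p
  if gap ≤ 2 then 50 else 48 / (gap - 1) + 2

/-- **`log(1 + p/q)` for `0 ≤ p`, `2p ≤ q`**: `log1pIv p q = some (lo, hi)` with
`lo/2⁸⁰ ≤ log(1 + p/q) ≤ hi/2⁸⁰` (`log1pIv_sound`); the series of `−log(1 − x)` at `x = −p/q`
(`|x| ≤ 1/2`) with `termsFor p q` terms and the exact remainder `(p/q)^{m+1}/(1 − p/q)`. [folklore] -/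
def log1pIv (p q : ℕ) : Option (ℤ × ℤ) :=
  if 0 < q ∧ 2 * p ≤ q then
    let m := termsFor p q
    let s := seriesSum (-(p : ℤ)) q m
    let r := remBound p q m
    some (-s - m - r, -s + r)
  else none

/-! ### Soundness -/

/-- The exact partial sum `∑_{j=i}^{i+fuel-1} x^j/j`. [folklore] -/
noncomputable def exactGo (x : ℝ) : ℕ → ℕ → ℝ
  | 0, _ => 0
  | fuel + 1, i => x ^ i / i + exactGo x fuel (i + 1)

/-- Floor division bounds: `q·d ≤ t < (q+1)·d` for `q = t/d`, `d > 0` (Euclidean division on `ℤ`),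
in `ℝ`. [folklore] -/
theorem ediv_bounds_real (t d : ℤ) (hd : 0 < d) :
    ((t / d : ℤ) : ℝ) ≤ (t : ℝ) / d ∧ (t : ℝ) / d ≤ ((t / d : ℤ) : ℝ) + 1 := by
  have h1 : (t / d) * d ≤ t := Int.ediv_mul_le t hd.ne'
  have h2 : t < (t / d + 1) * d := Int.lt_ediv_add_one_mul_self t hd
  have hdR : (0 : ℝ) < d := by exact_mod_cast hd
  have h1R : ((t / d : ℤ) : ℝ) * d ≤ t := by exact_mod_cast h1
  have h2R : (t : ℝ) < (((t / d : ℤ) : ℝ) + 1) * d := by exact_mod_cast h2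
  constructor
  · rw [le_div_iff₀ hdR]; exact h1R
  · rw [div_le_iff₀ hdR]; exact h2R.le

/-- **Fixed-point sum versus exact sum**: with `x = a/d` (`d ≥ 1`), `pow = a^i`, `dpow = d^i` (`i ≥ 1`),
`go ≤ acc + 2⁸⁰·exact ≤ go + fuel`. [folklore] -/
theorem seriesGo_bounds (a : ℤ) {d : ℕ} (hd : 1 ≤ d) :
    ∀ (fuel i : ℕ) (acc : ℤ), 1 ≤ i →
      ((seriesGo a d fuel i (a ^ i) (d ^ i) acc : ℤ) : ℝ) ≤ (acc : ℝ) + (LOGSC : ℝ) * exactGo ((a : ℝ) / d) fuel i ∧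
      (acc : ℝ) + (LOGSC : ℝ) * exactGo ((a : ℝ) / d) fuel i ≤
        ((seriesGo a d fuel i (a ^ i) (d ^ i) acc : ℤ) : ℝ) + fuel := by
  intro fuel
  induction fuel with
  | zero => intro i acc _; simp [seriesGo, exactGo]
  | succ fuel ih =>
    intro i acc hi
    have hi0 : i ≠ 0 := by omega
    have hd0 : (0 : ℤ) < ((d ^ i : ℕ) : ℤ) := by positivity
    have hdd : (0 : ℤ) < (i : ℤ) * ((d ^ i : ℕ) : ℤ) := by positivity
    obtain ⟨hq1, hq2⟩ := ediv_bounds_real (a ^ i * LOGSC) ((i : ℤ) * ((d ^ i : ℕ) : ℤ)) hdd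
    push_cast at hq1 hq2
    -- the real value of the term
    have hdR : (0 : ℝ) < d := by exact_mod_cast hd
    have hterm : (LOGSC : ℝ) * (((a : ℝ) / d) ^ i / i) =
        ((a ^ i * LOGSC : ℤ) : ℝ) / (((i : ℤ) * ((d ^ i : ℕ) : ℤ) : ℤ) : ℝ) := by
      have hiR : (i : ℝ) ≠ 0 := by exact_mod_cast hi0
      push_cast
      rw [div_pow]
      field_simp
    have hrec := ih (i + 1) (acc + a ^ i * LOGSC / ((i : ℤ) * ((d ^ i : ℕ) : ℤ))) (by omega)
    obtain ⟨r1, r2⟩ := hrec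
    have hstep : seriesGo a d (fuel + 1) i (a ^ i) (d ^ i) acc =
        seriesGo a d fuel (i + 1) (a ^ (i + 1)) (d ^ (i + 1)) (acc + a ^ i * LOGSC / ((i : ℤ) * ((d ^ i : ℕ) : ℤ))) := by
      simp only [seriesGo, Nat.cast_pow]
      rw [show a ^ i * a = a ^ (i + 1) by ring, show d ^ i * d = d ^ (i + 1) by ring]
    have hex : exactGo ((a : ℝ) / d) (fuel + 1) i =
        ((a : ℝ) / d) ^ i / i + exactGo ((a : ℝ) / d) fuel (i + 1) := rfl
    rw [hstep, hex, mul_add, hterm]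
    rw [Int.cast_add] at r1 r2
    push_cast [Nat.cast_succ] at r1 r2 hq1 hq2 ⊢
    constructor
    · linarith
    · linarith

/-- The exact partial sum is the Taylor polynomial of `−log(1−x)`:
`exactGo x m (i+1) = ∑_{j<m} x^{i+j+1}/(i+j+1)`. [folklore] -/
theorem exactGo_eq_sum (x : ℝ) : ∀ m i : ℕ,
    exactGo x m (i + 1) = ∑ j ∈ range m, x ^ (i + j + 1) / ((i + j + 1 : ℕ) : ℝ) := by
  intro m
  induction m with
  | zero => intro i; simp [exactGo]
  | succ m ih =>
    intro i
    rw [exactGo, Finset.sum_range_succ', ih (i + 1), add_comm]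
    congr 1
    refine Finset.sum_congr rfl fun j _ => ?_
    rw [show i + 1 + j + 1 = i + (j + 1) + 1 by ring]

/-- **Soundness of `logIv`.** [folklore] -/
theorem logIv_sound {n : ℕ} {lo hi : ℤ} (h : logIv n = some (lo, hi)) :
    (lo : ℝ) / 2 ^ 80 ≤ Real.log n ∧ Real.log n ≤ (hi : ℝ) / 2 ^ 80 := by
  unfold logIv at h
  dsimp only at h
  split_ifs at h with hk
  obtain ⟨hk1, hk2⟩ := hk
  simp only [Option.some.injEq, Prod.mk.injEq] at h
  obtain ⟨hlo, hhi⟩ := h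
  set k := findK n with hkdef
  set a : ℤ := (2 : ℤ) ^ k - n with ha
  set x : ℝ := (a : ℝ) / 2 ^ k with hx
  have h2k : (0 : ℝ) < 2 ^ k := by positivity
  have hn1 : 1 ≤ n := by
    rcases Nat.eq_zero_or_pos n with h0 | h0
    · rw [h0] at hk1; simp at hk1
    · exact h0
  have hn : (1 : ℝ) ≤ n := by exact_mod_cast hn1
  -- `|x| ≤ 1/3` and `n = 2^k (1 - x)`
  have hx_eq : (n : ℝ) = 2 ^ k * (1 - x) := by
    rw [hx, ha]; push_cast; field_simp; ring
  have hxabs : |x| ≤ 1 / 3 := by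
    rw [hx, abs_div, abs_of_pos h2k, div_le_iff₀ h2k, ha]
    have h1 : (2 : ℝ) * 2 ^ k ≤ 3 * n := by exact_mod_cast hk1
    have h2 : (3 : ℝ) * n ≤ 4 * 2 ^ k := by exact_mod_cast hk2
    rw [abs_le]; push_cast; constructor <;> linarith
  have hxlt : |x| < 1 := hxabs.trans_lt (by norm_num)
  have hx1 : 0 < 1 - x := by linarith [(abs_le.1 hxabs).2]
  -- the series estimate
  have hser := Real.abs_log_sub_add_sum_range_le hxlt NTERMS
  have hsum_eq : ∑ i ∈ range NTERMS, x ^ (i + 1) / (i + 1) = exactGo x NTERMS 1 := by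
    rw [exactGo_eq_sum x NTERMS 0]
    refine Finset.sum_congr rfl fun j _ => ?_
    simp
  have hrem : |x| ^ (NTERMS + 1) / (1 - |x|) ≤ (LOGREM : ℝ) / 2 ^ 80 := by
    have ha0 : 0 ≤ |x| := abs_nonneg _
    have h1 : |x| ^ (NTERMS + 1) / (1 - |x|) ≤ (1 / 3) ^ (NTERMS + 1) / (1 - 1 / 3) :=
      div_le_div₀ (by positivity) (pow_le_pow_left₀ ha0 hxabs _) (by norm_num) (by linarith)
    have h2 : ((3 / 2 : ℚ) * 2 ^ 80 / 3 ^ (NTERMS + 1) : ℚ) ≤ (LOGREM : ℚ) := Int.le_ceil _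
    have h4 : (((3 / 2 : ℚ) * 2 ^ 80 / 3 ^ (NTERMS + 1) : ℚ) : ℝ) ≤ ((LOGREM : ℚ) : ℝ) := by exact_mod_cast h2
    push_cast at h4
    have h3 : ((1 : ℝ) / 3) ^ (NTERMS + 1) / (1 - 1 / 3) = (3 / 2 : ℝ) * 2 ^ 80 / 3 ^ (NTERMS + 1) / 2 ^ 80 := by
      simp only [NTERMS]; norm_num
    rw [h3] at h1
    exact h1.trans (div_le_div_of_nonneg_right h4 (by positivity))
  -- fixed point sum
  obtain ⟨hs1, hs2⟩ := seriesGo_bounds a (d := 2 ^ k) (Nat.one_le_two_pow) NTERMS 1 0 le_rfl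
  rw [pow_one, pow_one] at hs1 hs2
  have hxd : ((a : ℝ) / ((2 ^ k : ℕ) : ℝ)) = x := by rw [hx]; push_cast; ring
  rw [hxd] at hs1 hs2
  have hSCv : (LOGSC : ℝ) = 2 ^ 80 := by simp only [LOGSC]; push_cast; ring
  have hs1' : ((seriesSum a (2 ^ k) NTERMS : ℤ) : ℝ) ≤ 2 ^ 80 * exactGo x NTERMS 1 := by
    have := hs1; simp only [Int.cast_zero, zero_add] at this; rw [hSCv] at this; exact this
  have hs2' : 2 ^ 80 * exactGo x NTERMS 1 ≤ ((seriesSum a (2 ^ k) NTERMS : ℤ) : ℝ) + NTERMS := by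
    have := hs2; simp only [Int.cast_zero, zero_add] at this; rw [hSCv] at this; exact this
  -- `log n = k log 2 + log (1 - x)`
  have hlogn : Real.log n = k * Real.log 2 + Real.log (1 - x) := by
    rw [hx_eq, Real.log_mul (by positivity) hx1.ne', Real.log_pow]
  -- `log 2` constants
  have hL2lo : ((L2LO : ℤ) : ℝ) ≤ 2 ^ 80 * Real.log 2 := by
    have h1 : ((L2LO : ℤ) : ℚ) ≤ (0.69314718055994530940 : ℚ) * 2 ^ 80 := Int.floor_le _
    have h2 : (((L2LO : ℤ) : ℚ) : ℝ) ≤ (((0.69314718055994530940 : ℚ) * 2 ^ 80 : ℚ) : ℝ) := by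
      exact_mod_cast h1
    have h3 := Literature.Analysis.SpecialFunctions.Real.log_two_gt_d20
    push_cast at h2
    nlinarith
  have hL2hi : 2 ^ 80 * Real.log 2 ≤ ((L2HI : ℤ) : ℝ) := by
    have h1 : (0.69314718055994530944 : ℚ) * 2 ^ 80 ≤ ((L2HI : ℤ) : ℚ) := Int.le_ceil _
    have h2 : (((0.69314718055994530944 : ℚ) * 2 ^ 80 : ℚ) : ℝ) ≤ (((L2HI : ℤ) : ℚ) : ℝ) := by
      exact_mod_cast h1
    have h3 := Literature.Analysis.SpecialFunctions.Real.log_two_lt_d20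
    push_cast at h2
    nlinarith
  have hk0 : (0 : ℝ) ≤ k := by positivity
  have habs := abs_le.1 (hser.trans hrem)
  rw [hsum_eq] at habs
  have hkl := mul_le_mul_of_nonneg_left hL2lo hk0
  have hku := mul_le_mul_of_nonneg_left hL2hi hk0
  rw [← hlo, ← hhi]
  push_cast
  rw [div_le_iff₀ (by positivity : (0:ℝ) < 2 ^ 80), le_div_iff₀ (by positivity : (0:ℝ) < 2 ^ 80),
    hlogn]
  constructor
  · nlinarith [habs.1, habs.2, hs1', hs2', hkl]
  · nlinarith [habs.1, habs.2, hs1', hs2', hku]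

/-- **Soundness of `log1pIv`.** [folklore] -/
theorem log1pIv_sound {p q : ℕ} {lo hi : ℤ} (h : log1pIv p q = some (lo, hi)) :
    (lo : ℝ) / 2 ^ 80 ≤ Real.log (1 + (p : ℝ) / q) ∧ Real.log (1 + (p : ℝ) / q) ≤ (hi : ℝ) / 2 ^ 80 := by
  unfold log1pIv at h
  split_ifs at h with hg
  obtain ⟨hq, hpq⟩ := hg
  simp only [Option.some.injEq, Prod.mk.injEq] at h
  obtain ⟨hlo, hhi⟩ := h
  set m := termsFor p q with hm
  have hqR : (0 : ℝ) < q := by exact_mod_cast hq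
  have hpqR : 2 * (p : ℝ) ≤ q := by exact_mod_cast hpq
  set x : ℝ := -((p : ℝ) / q) with hx
  have hxabs : |x| ≤ 1 / 2 := by
    rw [hx, abs_neg, abs_div, abs_of_nonneg (by positivity : (0 : ℝ) ≤ p), abs_of_pos hqR,
      div_le_iff₀ hqR]
    linarith
  have hxlt : |x| < 1 := hxabs.trans_lt (by norm_num)
  have hxy : |x| = (p : ℝ) / q := by
    rw [hx, abs_neg, abs_of_nonneg (by positivity)]
  -- series estimate
  have hser := Real.abs_log_sub_add_sum_range_le hxlt m
  have hsum_eq : ∑ i ∈ range m, x ^ (i + 1) / (i + 1) = exactGo x m 1 := by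
    rw [exactGo_eq_sum x m 0]
    refine Finset.sum_congr rfl fun j _ => ?_
    simp
  have h1x : (1 : ℝ) - x = 1 + (p : ℝ) / q := by rw [hx]; ring
  rw [hsum_eq, h1x] at hser
  -- remainder
  have hrem : |x| ^ (m + 1) / (1 - |x|) ≤ ((remBound p q m : ℤ) : ℝ) / 2 ^ 80 := by
    rw [hxy]
    have hqp : (0 : ℝ) < (q : ℝ) - p := by linarith [(Nat.cast_nonneg p : (0:ℝ) ≤ p)]
    have hq0 : (q : ℝ) ≠ 0 := hqR.ne'
    have hqp0 : (q : ℝ) - p ≠ 0 := hqp.ne'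
    have e : ((p : ℝ) / q) ^ (m + 1) / (1 - (p : ℝ) / q) =
        (2 : ℝ) ^ 80 * (p : ℝ) ^ (m + 1) / ((q : ℝ) ^ m * ((q : ℝ) - p)) / 2 ^ 80 := by
      rw [div_pow, show (1 : ℝ) - (p : ℝ) / q = ((q : ℝ) - p) / q by field_simp]
      rw [div_div_div_comm, div_div, eq_div_iff (by positivity)]
      field_simp
      ring
    rw [e]
    apply div_le_div_of_nonneg_right _ (by positivity)
    have h1 : ((2 : ℚ) ^ 80 * (p : ℚ) ^ (m + 1) / ((q : ℚ) ^ m * ((q : ℚ) - p)) : ℚ) ≤ (remBound p q m : ℚ) :=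
      Int.le_ceil _
    have h2 : (((2 : ℚ) ^ 80 * (p : ℚ) ^ (m + 1) / ((q : ℚ) ^ m * ((q : ℚ) - p)) : ℚ) : ℝ) ≤
        ((remBound p q m : ℚ) : ℝ) := by exact_mod_cast h1
    push_cast at h2
    exact h2
  -- fixed-point sum
  obtain ⟨hs1, hs2⟩ := seriesGo_bounds (-(p : ℤ)) (d := q) hq m 1 0 le_rfl
  rw [pow_one, pow_one] at hs1 hs2
  have hxd : (((-(p : ℤ) : ℤ) : ℝ) / (q : ℝ)) = x := by rw [hx]; push_cast; ring
  rw [hxd] at hs1 hs2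
  have hSCv : (LOGSC : ℝ) = 2 ^ 80 := by simp only [LOGSC]; push_cast; ring
  simp only [Int.cast_zero, zero_add] at hs1 hs2
  rw [hSCv] at hs1 hs2
  have habs := abs_le.1 (hser.trans hrem)
  have h80 : (0 : ℝ) < 2 ^ 80 := by positivity
  have u1 : 2 ^ 80 * (exactGo x m 1 + Real.log (1 + (p : ℝ) / q)) ≤ ((remBound p q m : ℤ) : ℝ) := by
    have := mul_le_mul_of_nonneg_left habs.2 h80.le
    rwa [mul_div_cancel₀ _ h80.ne'] at this
  have u2 : -(((remBound p q m : ℤ) : ℝ)) ≤ 2 ^ 80 * (exactGo x m 1 + Real.log (1 + (p : ℝ) / q)) := by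
    have := mul_le_mul_of_nonneg_left habs.1 h80.le
    rwa [mul_neg, mul_div_cancel₀ _ h80.ne'] at this
  have hss : seriesSum (-(p : ℤ)) q m = seriesGo (-(p : ℤ)) q m 1 (-(p : ℤ)) q 0 := rfl
  rw [← hlo, ← hhi, hss]
  push_cast
  rw [div_le_iff₀ h80, le_div_iff₀ h80]
  constructor
  · linarith
  · linarith

/-! ### Tests -/

example : (logIv 3).isSome = true := by decide +kernel
example : (logIv 599).isSome = true := by decide +kernel
example : (log1pIv 1 2003).isSome = true := by decide +kernel

end Literature.Analysis.SpecialFunctions.KernelLog
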